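import Mathlib

/-!
# Initial degeneration of vanishing loci (the algebraic Grassmannian limit)

Route `ValiantsHypothesis/BorderApolarity`, crux `ToricWitnessObstructionQP`
(stmt-ValiantsHypothesis-14753), line `Sketch`, lead c5 — second helper for the regime analysis of
torus leading forms of `per₃` below Grenet's size `7` (crux work note `regimes.md`, §3, step (iii)):
the passage from "the garbage-perturbed cubic `P₃` vanishes (with its partials) on a linear space
`W`" to "the torus leading form `per₃ = in_w P₃` vanishes on a linear space of the same dimension".

* `exists_initialSubspace`: for a weight `w : σ → ℕ` and a subspace `W ≤ K^σ` (`K` an infinite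
  field) there is a subspace `W'` with `dim W ≤ dim W'` such that for every HOMOGENEOUS `g` all of
  whose monomials have `w`-weight `≤ e` and which vanishes on `W`, the weight-`e` component
  `in_w g := weightedHomogeneousComponent w e g` vanishes on `W'`.

`W'` is the initial subspace `⊕_c π_c(F_c W)` (`F_c W` = vectors of `W` vanishing on the coordinates
of weight `< c`, `π_c` = projection to the weight-`c` coordinates), i.e. the limit of `s^{-w}·W` as
`s → ∞`; the proof is the algebraic form of that limit: along the curve `X(T) = Σ_c T^{M-c} x_c`
(`x_c ∈ F_c W`) one has `T^{w}·X(T) = T^M·Q(T)` with `Q(0) = y`, `g(X(T)) = 0` formally, and comparing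
the weight expansion (`IsWeightedHomogeneous` scaling) with the degree scaling gives
`T^{Mn}·Σ_j T^{e-j} g_j(Q(T)) = T^e·g(X(T)) = 0`, whose constant term is `g_e(y) = 0`.
-/

open MvPolynomial Module
open scoped Polynomial

-- the mandated summit-side namespace repeats a component by design (single-problem summit)
set_option linter.dupNamespace false

namespace Summit.ValiantsHypothesis.ValiantsHypothesis.Theorems.BorderApolarityToricWitnessObstructionQP

noncomputable section

namespace InitialDegeneration

variable {K : Type*} [Field K] {σ : Type*}

/-- Torus scaling of a weighted homogeneous polynomial: `h(u^{w}·Z) = u^j · h(Z)`. [folklore] -/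
theorem aeval_pow_mul_of_isWeightedHomogeneous {S : Type*} [CommRing S] [Algebra K S]
    (w : σ → ℕ) {h : MvPolynomial σ K} {j : ℕ} (hh : IsWeightedHomogeneous w h j)
    (u : S) (Z : σ → S) :
    aeval (fun v => u ^ w v * Z v) h = u ^ j * aeval Z h := by
  classical
  conv_lhs => rw [h.as_sum]
  conv_rhs => rw [h.as_sum]
  rw [map_sum, map_sum, Finset.mul_sum]
  refine Finset.sum_congr rfl fun d hd => ?_
  have hwd : Finsupp.weight w d = j := hh (mem_support_iff.1 hd)
  rw [MvPolynomial.aeval_monomial, MvPolynomial.aeval_monomial]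
  have hprod : (d.prod fun v e => (u ^ w v * Z v) ^ e) =
      u ^ Finsupp.weight w d * d.prod fun v e => Z v ^ e := by
    simp only [Finsupp.prod, mul_pow, Finset.prod_mul_distrib, ← pow_mul]
    rw [Finset.prod_pow_eq_pow_sum, Finsupp.weight_apply, Finsupp.sum]
    simp only [smul_eq_mul, mul_comm (d _) (w _)]
  rw [hprod, hwd]
  ring

/-- A polynomial vanishing on a subspace vanishes formally on `K[T]`-combinations of its vectors
(infinite field: evaluate at every scalar). [folklore] -/
theorem aeval_eq_zero_of_forall_mem [Fintype σ] [Infinite K] (W : Submodule K (σ → K)) (g : MvPolynomial σ K)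
    (hW : ∀ x ∈ W, eval x g = 0) (s : Finset ℕ) (p : ℕ → K[X]) (x : ℕ → σ → K)
    (hx : ∀ c ∈ s, x c ∈ W) :
    aeval (fun a => ∑ c ∈ s, Polynomial.C (x c a) * p c) g = 0 := by
  apply Polynomial.eq_zero_of_infinite_isRoot
  have hall : ∀ t : K, Polynomial.IsRoot (aeval (fun a => ∑ c ∈ s, Polynomial.C (x c a) * p c) g) t := by
    intro t
    rw [Polynomial.IsRoot.def, ← Polynomial.coe_aeval_eq_eval, comp_aeval_apply]
    have hpt : (fun a => (Polynomial.aeval t) (∑ c ∈ s, Polynomial.C (x c a) * p c)) =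
        ∑ c ∈ s, ((p c).eval t) • x c := by
      funext a
      simp only [map_sum, map_mul, Polynomial.aeval_C, Polynomial.coe_aeval_eq_eval,
        Algebra.algebraMap_self, RingHom.id_apply, Finset.sum_apply, Pi.smul_apply, smul_eq_mul]
      exact Finset.sum_congr rfl fun c _ => mul_comm _ _
    rw [hpt]
    have h := hW _ (W.sum_mem fun c hc => W.smul_mem ((p c).eval t) (hx c hc))
    rwa [← MvPolynomial.coe_aeval_eq_eval] at h
  exact Set.infinite_univ.mono fun t _ => hall t

/-- Weighted components of a homogeneous polynomial are homogeneous of the same degree. [folklore] -/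
theorem isHomogeneous_weightedHomogeneousComponent (w : σ → ℕ) {g : MvPolynomial σ K} {n : ℕ}
    (hg : g.IsHomogeneous n) (j : ℕ) : (weightedHomogeneousComponent w j g).IsHomogeneous n := by
  classical
  intro d hd
  rw [coeff_weightedHomogeneousComponent] at hd
  split_ifs at hd with h
  · exact hg hd
  · exact absurd rfl hd

/-- Rank–nullity for a restriction: `dim U = dim f(U) + dim (U ∩ ker f)`. [folklore] -/
theorem finrank_eq_finrank_map_add_finrank_inf_ker [Fintype σ] {V₂ : Type*} [AddCommGroup V₂]
    [Module K V₂] (U : Submodule K (σ → K)) (f : (σ → K) →ₗ[K] V₂) :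
    finrank K U = finrank K (U.map f) + finrank K (U ⊓ LinearMap.ker f : Submodule K _) := by
  have h := LinearMap.finrank_range_add_finrank_ker (f.domRestrict U)
  rw [LinearMap.range_domRestrict, LinearMap.ker_domRestrict] at h
  have e : (Submodule.comap U.subtype (LinearMap.ker f)) ≃ₗ[K]
      (U ⊓ LinearMap.ker f : Submodule K (σ → K)) := by
    have h1 : Submodule.comap U.subtype (LinearMap.ker f) =
        Submodule.comap U.subtype (U ⊓ LinearMap.ker f) := by
      rw [Submodule.comap_inf, Submodule.comap_subtype_self, top_inf_eq]
    rw [h1]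
    exact Submodule.comapSubtypeEquivOfLe inf_le_left
  rw [← e.finrank_eq]
  omega

/-- **Initial degeneration of vanishing loci.**  For a weight `w` and a subspace `W` of `K^σ`
(`K` infinite) there is a subspace `W'` of at least the same dimension (the initial subspace
`⊕_c π_c(F_c W)`, the limit of `s^{-w}·W`) such that the top `w`-weight component of every
homogeneous polynomial vanishing on `W` vanishes on `W'`. [folklore] -/
theorem exists_initialSubspace [Fintype σ] [DecidableEq σ] [Infinite K] (w : σ → ℕ)
    (W : Submodule K (σ → K)) :
    ∃ W' : Submodule K (σ → K), finrank K W ≤ finrank K W' ∧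
      ∀ (g : MvPolynomial σ K) (n e : ℕ), g.IsHomogeneous n →
        (∀ d ∈ g.support, Finsupp.weight w d ≤ e) → (∀ x ∈ W, MvPolynomial.eval x g = 0) →
        ∀ y ∈ W', MvPolynomial.eval y (weightedHomogeneousComponent w e g) = 0 := by
  classical
  -- coordinate projections: `π c` keeps the weight-`c` coordinates, `κ c` the weight-`< c` ones,
  -- `ν c` the weight-`≥ c` ones
  let π : ℕ → (σ → K) →ₗ[K] (σ → K) := fun c =>
    LinearMap.pi fun a => if w a = c then LinearMap.proj a else 0
  let κ : ℕ → (σ → K) →ₗ[K] (σ → K) := fun c =>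
    LinearMap.pi fun a => if w a < c then LinearMap.proj a else 0
  let ν : ℕ → (σ → K) →ₗ[K] (σ → K) := fun c =>
    LinearMap.pi fun a => if c ≤ w a then LinearMap.proj a else 0
  have hπ : ∀ c x a, π c x a = if w a = c then x a else 0 := by
    intro c x a; simp only [π, LinearMap.pi_apply]; split_ifs <;> rfl
  have hκ : ∀ c x a, κ c x a = if w a < c then x a else 0 := by
    intro c x a; simp only [κ, LinearMap.pi_apply]; split_ifs <;> rfl
  have hν : ∀ c x a, ν c x a = if c ≤ w a then x a else 0 := by
    intro c x a; simp only [ν, LinearMap.pi_apply]; split_ifs <;> rfl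
  have memκ : ∀ c x, x ∈ LinearMap.ker (κ c) ↔ ∀ a, w a < c → x a = 0 := by
    intro c x
    rw [LinearMap.mem_ker]
    constructor
    · intro h a ha
      have := congr_fun h a
      rwa [hκ, if_pos ha] at this
    · intro h
      funext a
      rw [hκ]
      split_ifs with ha
      · exact h a ha
      · rfl
  have memν : ∀ c x, x ∈ LinearMap.ker (ν c) ↔ ∀ a, c ≤ w a → x a = 0 := by
    intro c x
    rw [LinearMap.mem_ker]
    constructor
    · intro h a ha
      have := congr_fun h a
      rwa [hν, if_pos ha] at this
    · intro h
      funext a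
      rw [hν]
      split_ifs with ha
      · exact h a ha
      · rfl
  -- the filtration `F c = W ∩ {weight-(<c) coordinates vanish}` and the graded pieces `V c`
  let F : ℕ → Submodule K (σ → K) := fun c => W ⊓ LinearMap.ker (κ c)
  let V : ℕ → Submodule K (σ → K) := fun c => (F c).map (π c)
  let M : ℕ := Finset.univ.sup w
  have hwM : ∀ a, w a ≤ M := fun a => Finset.le_sup (Finset.mem_univ a)
  let W' : Submodule K (σ → K) := ⨆ c ∈ Finset.range (M + 1), V c
  have hFW : ∀ c, F c ≤ W := fun c => inf_le_left
  -- `V c` is supported on the weight-`c` coordinates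
  have hVsupp : ∀ c, ∀ z ∈ V c, ∀ a, w a ≠ c → z a = 0 := by
    rintro c _ ⟨x, -, rfl⟩ a ha
    rw [hπ, if_neg ha]
  refine ⟨W', ?_, ?_⟩
  · ---------------------------------------------------------------- dimension (equality in fact)
    -- (i) `F 0 = W`, `F (M+1) = ⊥`
    have hF0 : F 0 = W := by
      refine le_antisymm inf_le_left fun x hx => Submodule.mem_inf.2 ⟨hx, ?_⟩
      rw [memκ]
      intro a ha
      exact absurd ha (Nat.not_lt_zero _)
    have hFtop : F (M + 1) = ⊥ := by
      rw [eq_bot_iff]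
      intro x hx
      rw [Submodule.mem_bot]
      funext a
      exact (memκ _ x).1 (Submodule.mem_inf.1 hx).2 a (Nat.lt_succ_of_le (hwM a))
    -- (ii) `dim F c = dim V c + dim F (c+1)`
    have hstep : ∀ c, finrank K (F c) = finrank K (V c) + finrank K (F (c + 1)) := by
      intro c
      have h := finrank_eq_finrank_map_add_finrank_inf_ker (F c) (π c)
      have hker : (F c ⊓ LinearMap.ker (π c) : Submodule K _) = F (c + 1) := by
        ext x
        simp only [Submodule.mem_inf, LinearMap.mem_ker, F]
        constructor
        · rintro ⟨⟨hxW, hxκ⟩, hxπ⟩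
          refine ⟨hxW, (memκ _ x).2 fun a ha => ?_⟩
          rcases Nat.lt_succ_iff_lt_or_eq.1 ha with ha | ha
          · exact (memκ _ x).1 hxκ a ha
          · have := congr_fun hxπ a
            rwa [hπ, if_pos ha] at this
        · rintro ⟨hxW, hxκ⟩
          refine ⟨⟨hxW, (memκ _ x).2 fun a ha => (memκ _ x).1 hxκ a (Nat.lt_succ_of_lt ha)⟩, ?_⟩
          funext a
          rw [hπ]
          split_ifs with ha
          · exact (memκ _ x).1 hxκ a (by omega)
          · rfl
      rw [hker] at h
      exact h
    -- (iii) the graded pieces below `k` miss the weights `≥ k`, `V k` lives on weight `k`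
    have hdisj : ∀ k, (V k ⊓ ⨆ c ∈ Finset.range k, V c : Submodule K _) = ⊥ := by
      intro k
      have hle : (⨆ c ∈ Finset.range k, V c : Submodule K _) ≤ LinearMap.ker (ν k) := by
        refine iSup₂_le fun c hc => ?_
        intro z hz
        rw [memν]
        intro a ha
        exact hVsupp c z hz a (by have := Finset.mem_range.1 hc; omega)
      rw [eq_bot_iff]
      intro z hz
      obtain ⟨hz1, hz2⟩ := Submodule.mem_inf.1 hz
      rw [Submodule.mem_bot]
      funext a
      by_cases ha : w a = k
      · exact (memν _ z).1 (hle hz2) a ha.ge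
      · exact hVsupp k z hz1 a ha
    -- (iv) induction: `dim (⨆_{c<k} V c) + dim F k = dim W`
    have hind : ∀ k, finrank K (⨆ c ∈ Finset.range k, V c : Submodule K _) + finrank K (F k) =
        finrank K W := by
      intro k
      induction k with
      | zero =>
        have h0 : (⨆ c ∈ Finset.range 0, V c : Submodule K (σ → K)) = ⊥ := by
          simp [Finset.range_zero]
        rw [h0, finrank_bot, hF0, zero_add]
      | succ k ih =>
        have hsup : (⨆ c ∈ Finset.range (k + 1), V c : Submodule K (σ → K)) =
            V k ⊔ ⨆ c ∈ Finset.range k, V c := by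
          rw [Finset.range_add_one, Finset.iSup_insert]
        have hdim := Submodule.finrank_sup_add_finrank_inf_eq (V k)
          (⨆ c ∈ Finset.range k, V c : Submodule K (σ → K))
        rw [hdisj k, finrank_bot, add_zero] at hdim
        rw [hsup, hdim]
        have := hstep k
        omega
    have h := hind (M + 1)
    rw [hFtop, finrank_bot, add_zero] at h
    exact h.ge
  · ---------------------------------------------------------------- degeneration of vanishing
    intro g n e hg hwe hgW y hy
    obtain ⟨μ, hμ⟩ := (Submodule.mem_iSup_finset_iff_exists_sum _ _).1 hy
    have hμV : ∀ c, ∃ x ∈ F c, π c x = (μ c : σ → K) := fun c => Submodule.mem_map.1 (μ c).2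
    choose x hxF hxπ using hμV
    have hxW : ∀ c, x c ∈ W := fun c => hFW c (hxF c)
    have hx0 : ∀ c a, w a < c → x c a = 0 := fun c => (memκ c (x c)).1 (Submodule.mem_inf.1 (hxF c)).2
    -- the curve `X(T)` in `W ⊗ K[T]` and its rescaling `Q(T)`, `T^{w} X = T^M Q`, `Q(0) = y`
    let T : K[X] := Polynomial.X
    let Xc : σ → K[X] := fun a => ∑ c ∈ Finset.range (M + 1), Polynomial.C (x c a) * T ^ (M - c)
    let Q : σ → K[X] := fun a => ∑ c ∈ Finset.range (M + 1), Polynomial.C (x c a) * T ^ (w a - c)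
    have hXzero : aeval Xc g = 0 :=
      aeval_eq_zero_of_forall_mem W g hgW _ (fun c => T ^ (M - c)) x fun c _ => hxW c
    have hXQ : ∀ a, T ^ w a * Xc a = T ^ M * Q a := by
      intro a
      simp only [Xc, Q, Finset.mul_sum]
      refine Finset.sum_congr rfl fun c hc => ?_
      have hcM : c ≤ M := Nat.lt_succ_iff.1 (Finset.mem_range.1 hc)
      by_cases hxa : x c a = 0
      · simp [hxa]
      · have hca : c ≤ w a := by
          by_contra hlt
          exact hxa (hx0 c a (by omega))
        have hexp : w a + (M - c) = M + (w a - c) := by omega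
        rw [mul_left_comm, ← pow_add, mul_left_comm, ← pow_add, hexp]
    have hQ0 : ∀ a, (Q a).eval 0 = y a := by
      intro a
      have hya : y a = x (w a) a := by
        rw [← hμ, Finset.sum_apply]
        simp only [← hxπ, hπ]
        rw [Finset.sum_ite_eq (Finset.range (M + 1)) (w a) (fun c => x c a)]
        rw [if_pos (Finset.mem_range.2 (Nat.lt_succ_of_le (hwM a)))]
      rw [hya]
      simp only [Q, Polynomial.eval_finsetSum, Polynomial.eval_mul, Polynomial.eval_C,
        Polynomial.eval_pow, Polynomial.eval_X, T]
      rw [Finset.sum_eq_single (w a)]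
      · simp
      · intro c hc hne
        by_cases hlt : w a < c
        · rw [hx0 c a hlt, zero_mul]
        · have : 0 < w a - c := by omega
          rw [zero_pow this.ne', mul_zero]
      · intro h
        exact absurd (Finset.mem_range.2 (Nat.lt_succ_of_le (hwM a))) h
    -- the weight expansion against the degree scaling
    set gc : ℕ → MvPolynomial σ K := fun j => weightedHomogeneousComponent w j g with hgc
    have hsum : ∑ j ∈ Finset.range (e + 1), gc j = g := by
      have h := sum_weightedHomogeneousComponent w g
      rw [finsum_eq_sum_of_support_subset _ (s := Finset.range (e + 1))] at h
      · exact h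
      · intro j hj
        rw [Function.mem_support] at hj
        rw [Finset.coe_range, Set.mem_Iio, Nat.lt_succ_iff]
        by_contra hje
        exact hj (weightedHomogeneousComponent_eq_zero' j g fun d hd => by
          have := hwe d hd; omega)
    let Φ : K[X] := ∑ j ∈ Finset.range (e + 1), T ^ (e - j) * aeval Q (gc j)
    have hkey : T ^ (M * n) * Φ = T ^ e * aeval Xc g := by
      simp only [Φ, Finset.mul_sum]
      rw [← hsum, map_sum, Finset.mul_sum]
      refine Finset.sum_congr rfl fun j hj => ?_
      have hje : j ≤ e := Nat.lt_succ_iff.1 (Finset.mem_range.1 hj)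
      -- degree scaling
      have h1 : T ^ (M * n) * aeval Q (gc j) = aeval (fun a => T ^ M * Q a) (gc j) := by
        have hhom : IsWeightedHomogeneous (1 : σ → ℕ) (gc j) n :=
          isHomogeneous_weightedHomogeneousComponent w hg j
        have := aeval_pow_mul_of_isWeightedHomogeneous (1 : σ → ℕ) hhom (T ^ M) Q
        simp only [Pi.one_apply, pow_one] at this
        rw [this, ← pow_mul]
      -- weight scaling
      have h2 : aeval (fun a => T ^ w a * Xc a) (gc j) = T ^ j * aeval Xc (gc j) :=
        aeval_pow_mul_of_isWeightedHomogeneous w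
          (weightedHomogeneousComponent_isWeightedHomogeneous (w := w) j g) T Xc
      have h3 : (fun a => T ^ M * Q a) = fun a => T ^ w a * Xc a := funext fun a => (hXQ a).symm
      calc T ^ (M * n) * (T ^ (e - j) * aeval Q (gc j))
          = T ^ (e - j) * (T ^ (M * n) * aeval Q (gc j)) := by ring
        _ = T ^ (e - j) * (T ^ j * aeval Xc (gc j)) := by rw [h1, h3, h2]
        _ = T ^ e * aeval Xc (gc j) := by
            rw [← mul_assoc, ← pow_add, Nat.sub_add_cancel hje]
    rw [hXzero, mul_zero] at hkey
    have hΦ : Φ = 0 := by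
      rcases mul_eq_zero.1 hkey with h | h
      · exact absurd h (pow_ne_zero _ Polynomial.X_ne_zero)
      · exact h
    -- constant term
    have hΦ0 : Φ.eval 0 = MvPolynomial.eval y (gc e) := by
      simp only [Φ, Polynomial.eval_finsetSum, Polynomial.eval_mul, Polynomial.eval_pow,
        Polynomial.eval_X, T]
      rw [Finset.sum_eq_single e]
      · rw [Nat.sub_self, pow_zero, one_mul, ← Polynomial.coe_aeval_eq_eval, comp_aeval_apply]
        have hfun : (fun a => (Polynomial.aeval (0 : K)) (Q a)) = y := by
          funext a
          rw [Polynomial.coe_aeval_eq_eval, hQ0]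
        rw [hfun]
        rfl
      · intro j hj hne
        have hje : j < e := lt_of_le_of_ne (Nat.lt_succ_iff.1 (Finset.mem_range.1 hj)) hne
        rw [zero_pow (by omega), zero_mul]
      · intro h
        exact absurd (Finset.mem_range.2 (Nat.lt_succ_self e)) h
    rw [← hΦ0, hΦ, Polynomial.eval_zero]

end InitialDegeneration

/-- **Initial degeneration of vanishing loci** (registered helper form of
`InitialDegeneration.exists_initialSubspace`): the top weight component of every homogeneous
polynomial vanishing on a subspace `W` vanishes on a subspace of at least the same dimension.
[folklore] -/
theorem initialDegeneration_of_vanishing : ∀ {K : Type*} [Field K] {σ : Type*} [Fintype σ] [DecidableEq σ] [Infinite K] (w : σ → ℕ) (W : Submodule K (σ → K)), ∃ W' : Submodule K (σ → K), Module.finrank K ↥W ≤ Module.finrank K ↥W' ∧ ∀ (g : MvPolynomial σ K) (n e : ℕ), g.IsHomogeneous n → (∀ d ∈ g.support, Finsupp.weight w d ≤ e) → (∀ x ∈ W, MvPolynomial.eval x g = 0) → ∀ y ∈ W', MvPolynomial.eval y (MvPolynomial.weightedHomogeneousComponent w e g) = 0 :=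
  fun w W => InitialDegeneration.exists_initialSubspace w W

end

end Summit.ValiantsHypothesis.ValiantsHypothesis.Theorems.BorderApolarityToricWitnessObstructionQP
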